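import Literature.AlgebraicGeometry.AbelianSchemes.IdealTorsionSubgroupScheme
import Literature.AlgebraicGeometry.AbelianSchemes.AbelianSchemeOverField
import Literature.AlgebraicGeometry.Motives.AbelianVarietyTorsionSubschemeEtale
import Literature.AlgebraicGeometry.GroupSchemes.CartierDualAnnihilatorFlat
import Literature.AlgebraicGeometry.GroupSchemes.AdmissibleIdealTransport
import Mathlib.RingTheory.LocalRing.Module
import HarnessLib

/-!
# The generic fibre of the `𝔭`-torsion layer `A[𝔭]` is ÉTALE, and the number of geometric `𝔭`-torsion points upstairs is the RANK of
# `A[𝔭]` — read off ANY fibre, e.g. the special one ([MumfordAV1970] §7 Thm. 4, §6 App. 3; [Tate1997FiniteFlatGroupSchemes] (3.7); [EGAIV2] 2.8)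

Topic `Literature/AlgebraicGeometry/AbelianSchemes`; namespace `Literature.AlgebraicGeometry.AbelianSchemes.AbelianSchemeOver.IdealTorsion` (sequel of ★
`IdealTorsionSubgroupScheme`, organ (S-c)).  THEOREMS ONLY (no definition, no instance, no notation, no named fact, no `sorry`).  Cell `hodgecm-mathlib`
(D-0151), programme P6 «MOD» (crux hLiu418 = stmt-HodgeConjecture-24832, `--supports`, count-neutral): organ **(GF) «THE GENERIC FIBRE OF THE
`𝔭`-TORSION LAYER»** (LDEAL v1 §L1 T2 GENERIC-FIBRE road; B-p10 (g30) letter 2026-09-02T02:15:36Z (GF-a)–(GF-d); LA1-plan (g0) 02:17:42Z «label L2∕(S-c)»):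
the ORDER INPUT `#A_y[𝔭](Ω) = q²` of the D-line sockets `stub_SPEC` ∕ `stub_LINES` (`Cruxes/HLiu418/Lines/F0_P6a_DatumOfInputs.lean`: the carrier `LineOf I y`
and ★ (L-q-lin) `LinesInRankTwoTorsionModule.natCard_submodules_of_isTorsionBySet (hcard : Nat.card M = Nat.card (O ⧸ 𝔭) ^ 2)`) comes DOWN → UP: ★ (S-c)
realises `A[𝔭] := Ker ψ_P ↪ A` as a finite flat closed subgroup scheme over ANY base with the kernel-of-`𝔭` clause on all points, base change and
uniqueness, but computes NO rank and NO point count.  Here: (GF-a) over a field `K` in which the integer `N ∈ 𝔭` of the presentation is invertible,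
`A[𝔭]_K → Spec K` is ÉTALE (it is a closed subscheme of the abelian variety `A_K` killed by `N`, ★ `Motives.AbelianVariety.etale_hom_of_pow_eq_one`);
(GF-b) over an algebraically closed such `K` the `𝔭`-torsion points `{P ∈ A(K) | ι(a)P = 1 ∀ a ∈ 𝔭}` therefore number `dim_K Γ(A[𝔭]_K, 𝒪)` (★
`Motives.natCard_specHom_eq_finrank`); (GF-c) over a LOCAL base `R`, `Γ(A[𝔭], 𝒪)` is finite flat hence FREE (Mathlib `Module.free_of_flat_of_isLocalRing`,
no finite presentation needed — valuation rings included), so EVERY fibre `A[𝔭]_L`, `R → L` a field, has degree `rk_R Γ(A[𝔭], 𝒪)`; (GF-d) hence the number of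
geometric generic `𝔭`-torsion points equals the degree of the special fibre, which the consumer reads off the dock (`hrkG₀ = q²` through `hkerG₀` and ★
(S-c) §4 uniqueness) — the DOCK FORM `natCard_idealTorsion_algPoints_baseChange_eq_finrank_of_forall_iff` takes any monomorphism `G' ↪ A_L` with the
kernel-of-`𝔭` clause and returns `#{P ∈ A_K(K) | 𝔭P = 1} = dim_L Γ(G', 𝒪)`.  No `2 dim A ∕ [F:ℚ]` numerology and no characteristic-zero `𝒪⧸𝔭`-module
theory is used.  HC_CM is proved only modulo the printed citations until rung 0 closes; this file is generic and changes no count.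

THE PRINT.  [MumfordAV1970] §7 Thm. 4 (p. 72) ∕ §6 Application 3 (p. 64): in characteristic prime to the order, finite subgroup schemes of abelian varieties
are étale and `A[n](k̄) ≅ (ℤ∕n)^{2g}`; [GortzWedhorn2023] Prop. 27.187, Cor. 27.63 (the Cartier-free route used by ★ `AbelianVarietyTorsionSubschemeEtale`);
[Tate1997FiniteFlatGroupSchemes] (3.7): a finite flat group scheme over a local base has a well-defined ORDER = the rank of its (free) affine algebra,
equal to the degree of every fibre, and a finite étale group over `k̄` «is» its group of points; [EGAIV2] §2.8 (flatness over valuation rings);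
[StacksProject] 00NZ (finite flat over local is free), 00U3 (étale algebras over separably closed fields split).  PRESENTATION (as in ★ (S-c), hypotheses
here): `𝔟 = E′·𝒪ᵐ` (`E′² = E′`), a column `P` with `E′P = P` whose entries generate `𝔭`, a quasi-inverse row `Q` (`QE′ = Q`, `QP = N·1`, `PQ = N·E′`,
`N ≠ 0`); so `N = Σ_k Q_{0k} P_{k0} ∈ 𝔭` and `A[𝔭]` is killed by `N`.

## Contents (`𝒢 := ker (serreTranslate act E′ hE′ P)`, `ι := kerι _`; ★ instances `grpObjKer`, `isMonHom_kerι`)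
* §1 (any base `S`) `natCast_mem_span_range` (`N ∈ 𝔭`), `comp_i_natCast` (`t ≫ ι(n) = tⁿ`), **`kerι_serreTranslate_pow_eq_one`** (`ι ^ N = 1`),
  `natCard_idealTorsion_points_eq` (`#{t ∈ A(T) | 𝔭t = 1} = #𝒢(T)`, ★ (S-c) §1 + `mono_kerι`).
* §2 (base a field `K`, `(N : K) ≠ 0`) **`etale_ker_serreTranslate_hom`** (`𝒢 → Spec K` étale); for `K` algebraically closed
  `natCard_algPoints_ker_eq_finrank` (`#𝒢(K) = dim_K Γ(𝒢)`) and **`natCard_idealTorsion_algPoints_eq_finrank`** (`#{P ∈ A(K) | 𝔭P = 1} = dim_K Γ(𝒢)`).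
* §3 (affine base `Spec R`) `AffineGroupScheme.Alg.moduleFlat_of_flat` (generic: `G → Spec R` flat, `G` affine ⇒ `Γ(G)` a flat `R`-module — the tree so far
  only ASSUMED `[Module.Flat R (Alg G)]`), `moduleFinite_alg_ker`, `moduleFlat_alg_ker`, **`moduleFree_alg_ker`** (`R` local), **`finrank_alg_pullback_ker_eq`**
  (`dim_L Γ(𝒢_L) = rk_R Γ(𝒢)` for every `R`-field `L`, ★ `AffineGroupScheme.finrank_alg_pullback_obj`).
* §4 (local base `R`, `K` an algebraically closed `R`-field with `(N : K) ≠ 0`, `L` any `R`-field) **`natCard_idealTorsion_algPoints_baseChange_eq_finrank`**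
  (`#{P ∈ A_K(K) | 𝔭P = 1} = dim_L Γ(𝒢_L)`, through ★ (S-c) §3 `exists_baseChange_iso`) and the DOCK FORM
  **`natCard_idealTorsion_algPoints_baseChange_eq_finrank_of_forall_iff`** (`= dim_L Γ(G′)` for any mono `G′ ↪ A_L` with the kernel-of-`𝔭` clause, ★ (S-c) §4
  `exists_iso_of_forall_iff` + ★ `AdmIdealTransport.exists_algEquiv_of_iso`).

## References
* [MumfordAV1970] D. Mumford, *Abelian Varieties*, TIFR Studies in Mathematics 5 (1970), §6 Application 3 (p. 64), §7 Thm. 4 (p. 72).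
* [GortzWedhorn2023] U. Görtz, T. Wedhorn, *Algebraic Geometry II* (2023), Prop. 27.187, Cor. 27.63; §(27.2) (27.2.1) (pp. 606–607).
* [GortzWedhorn2020] U. Görtz, T. Wedhorn, *Algebraic Geometry I*, 2nd ed. (2020), Section (4.7), (4.7.1) (p. 108); Definition 4.45 (2) (p. 117).
* [Tate1997FiniteFlatGroupSchemes] J. Tate, *Finite flat group schemes*, in: Modular Forms and Fermat's Last Theorem (1997), (3.7).
* [EGAIV2] A. Grothendieck, *Éléments de géométrie algébrique* IV₂, Publ. Math. IHÉS 24 (1965), §2.8 (Prop. 2.8.5).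
* [StacksProject] The Stacks Project, Tags 00NZ, 00U3.
-/

set_option autoImplicit false

-- Mathlib's `Over`/`Scheme` APIs are stated across semireducible wrappers (as in the ★ `GroupSchemes/*` base-change files).
set_option backward.isDefEq.respectTransparency false

noncomputable section

universe u

open CategoryTheory CategoryTheory.Limits AlgebraicGeometry MonoidalCategory CartesianMonoidalCategory
open scoped MonObj CategoryTheory.Obj
open Literature.AlgebraicGeometry.GroupSchemes Literature.AlgebraicGeometry.GroupSchemes.GroupSchemeKernel
open Literature.AlgebraicGeometry.GroupSchemes.AffineGroupScheme (Alg)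
open Literature.AlgebraicGeometry.Motives (SchemeOver specOver AlgPoints)

namespace Literature.AlgebraicGeometry.AbelianSchemes

namespace AbelianSchemeOver

namespace IdealTorsion

/-! ## §1 Any base: `N ∈ 𝔭` kills `A[𝔭]`, and `𝔭`-torsion `T`-points of `A` are the `T`-points of `A[𝔭]` -/

section AnyBase

variable {S : Scheme.{u}} {A : AbelianSchemeOver S} {O : Type*} [CommRing O] (act : A.RingAction O) [IsCommMonObj A.X]
  {m : ℕ} (E' : Matrix (Fin m) (Fin m) O) (hE' : E' * E' = E') (P : Matrix (Fin m) (Fin 1) O) (Q : Matrix (Fin 1) (Fin m) O) {N : ℕ}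

omit [IsCommMonObj A.X] in
/-- The integer of the presentation lies in the ideal: `N = (QP)₀₀ = Σ_k Q_{0k} P_{k0} ∈ (P_{10}, …, P_{m0}) = 𝔭`.
[cite: MilneCM2006, §7 (𝔞-multiplications: `A[𝔞]` is killed by `𝔞 ∩ ℤ`)] -/
theorem natCast_mem_span_range (hQP : Q * P = Matrix.scalar (Fin 1) (N : O)) : (N : O) ∈ Ideal.span (Set.range fun k => P k 0) := by
  have h : (Q * P) 0 0 = (N : O) := by
    rw [hQP, Matrix.scalar_apply, Matrix.diagonal_apply_eq]
  rw [Matrix.mul_apply] at h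
  rw [← h]
  exact Ideal.sum_mem _ fun k _ => Ideal.mul_mem_left _ _ (Ideal.subset_span ⟨k, rfl⟩)

omit [IsCommMonObj A.X] in
/-- On points, the ring action of a natural number is the power map: `t ≫ ι(n) = tⁿ` (`ι(n·1) = ι(1)ⁿ = 𝟙ⁿ`, ★ `RingAction.i_nsmul`).
[cite: Kottwitz1992, §5 (p. 390)] -/
theorem comp_i_natCast {T : Over S} (t : T ⟶ A.X) (n : ℕ) : t ≫ act.i (n : O) = t ^ n := by
  rw [← Nat.smul_one_eq_cast, act.i_nsmul, act.i_one, MonObj.comp_pow, Category.comp_id]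

/-- **`A[𝔭] ↪ A` IS KILLED BY THE INTEGER `N ∈ 𝔭`**: `ι ^ N = 1` in the group `A(A[𝔭])` of `A[𝔭]`-valued points of `A` (★ (S-c) `kerι_comp_i_eq_one` at
`a := N`). [cite: MumfordAV1970, §7 Thm. 4 (p. 72)] [cite: MilneCM2006, §7] -/
theorem kerι_serreTranslate_pow_eq_one (hP : E' * P = P) (hQP : Q * P = Matrix.scalar (Fin 1) (N : O)) :
    kerι (serreTranslate act E' hE' P) ^ N = 1 := by
  rw [← comp_i_natCast act (kerι (serreTranslate act E' hE' P)) N]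
  exact kerι_comp_i_eq_one act E' hE' P hP rfl (natCast_mem_span_range P Q hQP)

/-- **THE `𝔭`-TORSION `T`-POINTS OF `A` ARE THE `T`-POINTS OF `A[𝔭]`**, as a count: `#{t ∈ A(T) | ι(a)t = 1 ∀ a ∈ 𝔭} = #A[𝔭](T)` for every `S`-scheme `T`
(`s ↦ s ≫ ι` is injective since `ι` is a monomorphism and surjective by the kernel-of-`𝔭` clause ★ (S-c) `exists_comp_kerι_eq_iff_forall_mem`).
[cite: GortzWedhorn2020, Definition 4.45 (2), p. 117] [cite: MilneCM2006, §7] -/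
theorem natCard_idealTorsion_points_eq (hP : E' * P = P) {𝔭 : Ideal O} (h𝔭 : Ideal.span (Set.range fun k => P k 0) = 𝔭) (T : Over S) :
    Nat.card {t : T ⟶ A.X // ∀ a ∈ 𝔭, t ≫ act.i a = 1} = Nat.card (T ⟶ ker (serreTranslate act E' hE' P)) := by
  haveI := mono_kerι (serreTranslate act E' hE' P)
  symm
  refine Nat.card_congr (Equiv.ofBijective
    (fun s => ⟨s ≫ kerι (serreTranslate act E' hE' P), (exists_comp_kerι_eq_iff_forall_mem act E' hE' P hP h𝔭 _).1 ⟨s, rfl⟩⟩) ⟨?_, ?_⟩)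
  · intro s₁ s₂ h
    exact (cancel_mono (kerι (serreTranslate act E' hE' P))).1 (congrArg Subtype.val h)
  · intro t
    obtain ⟨s, hs⟩ := (exists_comp_kerι_eq_iff_forall_mem act E' hE' P hP h𝔭 t.1).2 t.2
    exact ⟨s, Subtype.ext hs⟩

end AnyBase

/-! ## §2 Base a field `K` with `N` invertible: `A[𝔭]_K` is étale and its points are counted by its degree -/

section Field

variable {K : Type u} [Field K] {A : AbelianSchemeOver (Spec (.of K))} {O : Type*} [CommRing O] (act : A.RingAction O) [IsCommMonObj A.X]
  {m : ℕ} (E' : Matrix (Fin m) (Fin m) O) (hE' : E' * E' = E') (P : Matrix (Fin m) (Fin 1) O) (Q : Matrix (Fin 1) (Fin m) O) {N : ℕ}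

/-- **(GF-a) THE GENERIC FIBRE OF THE `𝔭`-TORSION LAYER IS ÉTALE**: over a field `K` with `N ≠ 0` in `K`, `A[𝔭] = Ker ψ_P → Spec K` is ÉTALE — `A[𝔭] ↪ A`
is a closed immersion (★ (S-c) `isClosedImmersion_kerι_serreTranslate_left`) killed by the invertible integer `N` (§1), so ★
`Motives.AbelianVariety.etale_hom_of_pow_eq_one` applies to the abelian variety `A` (★ `AbelianScheme.toAbelianVariety`, same `K`-group scheme).
[cite: MumfordAV1970, §7 Thm. 4 (p. 72)] [cite: GortzWedhorn2023, Prop. 27.187 and Cor. 27.63] -/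
theorem etale_ker_serreTranslate_hom (hN : (N : K) ≠ 0) (hP : E' * P = P) (hQP : Q * P = Matrix.scalar (Fin 1) (N : O)) :
    Etale (ker (serreTranslate act E' hE' P)).hom := by
  haveI := isClosedImmersion_kerι_serreTranslate_left act E' hE' P
  have hpow : kerι (serreTranslate act E' hE' P) ^ (N : ℤ) = 1 := by
    rw [zpow_natCast]
    exact kerι_serreTranslate_pow_eq_one act E' hE' P Q hP hQP
  have hNK : ((N : ℤ) : K) ≠ 0 := by exact_mod_cast hN
  exact Literature.AlgebraicGeometry.Motives.AbelianVariety.etale_hom_of_pow_eq_one (A := A.toAffine.toAbelianVariety)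
    (Z := ker (serreTranslate act E' hE' P)) (kerι (serreTranslate act E' hE' P)) (N : ℤ) hNK hpow

/-- **(GF-b) `#A[𝔭](K) = dim_K Γ(A[𝔭]_K, 𝒪)`** for `K` algebraically closed with `N ≠ 0` in `K`: the finite (★ (S-c) `isFinite_ker_hom`) ÉTALE `K`-scheme
`A[𝔭]_K` is split, so its `K`-points number its degree (★ `Motives.natCard_specHom_eq_finrank`). [cite: Tate1997FiniteFlatGroupSchemes, (3.7)]
[cite: StacksProject, Tag 00U3] [cite: MumfordAV1970, §6 Application 3 (p. 64)] -/
theorem natCard_algPoints_ker_eq_finrank [IsAlgClosed K] (hN : (N : K) ≠ 0) (hP : E' * P = P) (hQ : Q * E' = Q)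
    (hQP : Q * P = Matrix.scalar (Fin 1) (N : O)) (hPQ : P * Q = Matrix.scalar (Fin m) (N : O) * E') :
    Nat.card (AlgPoints (ker (serreTranslate act E' hE' P)) K) = Module.finrank K (Alg (ker (serreTranslate act E' hE' P))) := by
  have hN0 : N ≠ 0 := by
    rintro rfl
    exact hN (by simp)
  haveI := isAffine_ker_left act E' hE' P Q hN0 hP hQ hQP hPQ
  haveI := etale_ker_serreTranslate_hom act E' hE' P Q hN hP hQP
  have h := Literature.AlgebraicGeometry.Motives.natCard_specHom_eq_finrank (ker (serreTranslate act E' hE' P)).hom K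
  refine Eq.trans (Nat.card_congr ?_) h
  exact
    { toFun := fun u => ⟨u.left, Over.w u⟩
      invFun := fun x => Over.homMk x.1 x.2
      left_inv := fun _ => rfl
      right_inv := fun _ => rfl }

/-- **(GF-b′) THE NUMBER OF `𝔭`-TORSION POINTS OF `A(K)` IS THE DEGREE OF `A[𝔭]_K`**: `#{P ∈ A(K) | ι(a)P = 1 ∀ a ∈ 𝔭} = dim_K Γ(A[𝔭]_K, 𝒪)` for `K`
algebraically closed with `N ≠ 0` in `K` (§1 `natCard_idealTorsion_points_eq` + `natCard_algPoints_ker_eq_finrank`) — the `hcard` input of ★ (L-q-lin)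
`LinesInRankTwoTorsionModule` once the degree is known. [cite: MumfordAV1970, §6 Application 3 (p. 64), §7 Thm. 4 (p. 72)] [cite: Tate1997FiniteFlatGroupSchemes, (3.7)] -/
theorem natCard_idealTorsion_algPoints_eq_finrank [IsAlgClosed K] (hN : (N : K) ≠ 0) (hP : E' * P = P) (hQ : Q * E' = Q)
    (hQP : Q * P = Matrix.scalar (Fin 1) (N : O)) (hPQ : P * Q = Matrix.scalar (Fin m) (N : O) * E')
    {𝔭 : Ideal O} (h𝔭 : Ideal.span (Set.range fun k => P k 0) = 𝔭) :
    Nat.card {t : AlgPoints A.X K // ∀ a ∈ 𝔭, t ≫ act.i a = 1} = Module.finrank K (Alg (ker (serreTranslate act E' hE' P))) := by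
  rw [natCard_idealTorsion_points_eq act E' hE' P hP h𝔭 (specOver K K)]
  exact natCard_algPoints_ker_eq_finrank act E' hE' P Q hN hP hQ hQP hPQ

end Field

/-! ## §3 Affine base `Spec R`: `Γ(A[𝔭], 𝒪)` is finite flat, FREE over a local `R`, and every fibre has its rank -/

section AffineBase

variable {R : Type u} [CommRing R]

/-- **A FLAT AFFINE `R`-SCHEME HAS A FLAT AFFINE ALGEBRA**: if `G → Spec R` is flat and `G` is affine then `Γ(G, 𝒪)` is a flat `R`-module (`G ≅ Spec Γ(G)`
over `Spec R`, ★ `Motives.isoSpec_hom_comp_SpecMap_algebraMapΓ`; Mathlib `HasRingHomProperty.Spec_iff`, `RingHom.flat_algebraMap_iff`).  Generic glue: the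
★ `GroupSchemes/*` special-fibre files take `[Module.Flat R (Alg G)]` as a binder. [cite: GortzWedhorn2023, §(27.2) (27.2.1) (pp. 606–607)]
[cite: EGAIV2, §2.8 (Prop. 2.8.5)] -/
theorem _root_.Literature.AlgebraicGeometry.GroupSchemes.AffineGroupScheme.Alg.moduleFlat_of_flat (G : SchemeOver R) [IsAffine G.left]
    [Flat G.hom] : Module.Flat R (Alg G) := by
  have h : Flat (G.left.isoSpec.hom ≫ Spec.map (Literature.AlgebraicGeometry.Motives.algebraMapΓ G.hom)) := by
    rw [Literature.AlgebraicGeometry.Motives.isoSpec_hom_comp_SpecMap_algebraMapΓ G.hom]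
    infer_instance
  have h2 : Flat (Spec.map (Literature.AlgebraicGeometry.Motives.algebraMapΓ G.hom)) :=
    (MorphismProperty.cancel_left_of_respectsIso @Flat _ _).mp h
  rw [HasRingHomProperty.Spec_iff (P := @Flat)] at h2
  exact RingHom.flat_algebraMap_iff.mp h2

variable {A : AbelianSchemeOver (Spec (.of R))} {O : Type*} [CommRing O] (act : A.RingAction O) [IsCommMonObj A.X]
  {m : ℕ} (E' : Matrix (Fin m) (Fin m) O) (hE' : E' * E' = E') (P : Matrix (Fin m) (Fin 1) O) (Q : Matrix (Fin 1) (Fin m) O) {N : ℕ}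

/-- `Γ(A[𝔭], 𝒪)` is a FINITE `R`-module (★ (S-c) `isFinite_ker_hom`, ★ `AffineGroupScheme.Alg.moduleFinite`). [cite: Tate1997FiniteFlatGroupSchemes, (3.7)]
[cite: GortzWedhorn2023, §(27.2) (27.2.1) (pp. 606–607)] -/
theorem moduleFinite_alg_ker (hN : N ≠ 0) (hP : E' * P = P) (hQ : Q * E' = Q)
    (hQP : Q * P = Matrix.scalar (Fin 1) (N : O)) (hPQ : P * Q = Matrix.scalar (Fin m) (N : O) * E') :
    Module.Finite R (Alg (ker (serreTranslate act E' hE' P))) := by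
  haveI := isFinite_ker_hom act E' hE' P Q hN hP hQ hQP hPQ
  exact AffineGroupScheme.Alg.moduleFinite _

/-- `Γ(A[𝔭], 𝒪)` is a FLAT `R`-module (★ (S-c) `flat_ker_hom` + `Alg.moduleFlat_of_flat`). [cite: Tate1997FiniteFlatGroupSchemes, (3.7)] [cite: EGAIV2, §2.8 (Prop. 2.8.5)] -/
theorem moduleFlat_alg_ker (hN : N ≠ 0) (hP : E' * P = P) (hQ : Q * E' = Q)
    (hQP : Q * P = Matrix.scalar (Fin 1) (N : O)) (hPQ : P * Q = Matrix.scalar (Fin m) (N : O) * E') :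
    Module.Flat R (Alg (ker (serreTranslate act E' hE' P))) := by
  haveI := isAffine_ker_left act E' hE' P Q hN hP hQ hQP hPQ
  haveI := flat_ker_hom act E' hE' P Q hN hP hQ hQP hPQ
  exact AffineGroupScheme.Alg.moduleFlat_of_flat _

/-- **(GF-c) OVER A LOCAL BASE `Γ(A[𝔭], 𝒪)` IS FREE** — finite flat over a local ring is free (Mathlib `Module.free_of_flat_of_isLocalRing`; no finite
presentation is needed, so valuation rings are covered): `A[𝔭] → Spec R` has a well-defined ORDER `rk_R Γ(A[𝔭], 𝒪)`. [cite: StacksProject, Tag 00NZ]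
[cite: Tate1997FiniteFlatGroupSchemes, (3.7)] -/
theorem moduleFree_alg_ker [IsLocalRing R] (hN : N ≠ 0) (hP : E' * P = P) (hQ : Q * E' = Q)
    (hQP : Q * P = Matrix.scalar (Fin 1) (N : O)) (hPQ : P * Q = Matrix.scalar (Fin m) (N : O) * E') :
    Module.Free R (Alg (ker (serreTranslate act E' hE' P))) := by
  haveI := moduleFinite_alg_ker act E' hE' P Q hN hP hQ hQP hPQ
  haveI := moduleFlat_alg_ker act E' hE' P Q hN hP hQ hQP hPQ
  exact Module.free_of_flat_of_isLocalRing

/-- **(GF-c) EVERY FIBRE OF `A[𝔭]` OVER A LOCAL BASE HAS DEGREE `rk_R Γ(A[𝔭], 𝒪)`**: for every field `L` under `R` (the generic point, the special point, any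
geometric point), `dim_L Γ(A[𝔭]_L, 𝒪) = rk_R Γ(A[𝔭], 𝒪)` (`Γ(A[𝔭]_L) ≅ L ⊗_R Γ(A[𝔭])`, ★ `AffineGroupScheme.finrank_alg_pullback_obj`).
[cite: Tate1997FiniteFlatGroupSchemes, (3.7)] [cite: GortzWedhorn2020, Section (4.7), (4.7.1) (p. 108)] -/
theorem finrank_alg_pullback_ker_eq [IsLocalRing R] (hN : N ≠ 0) (hP : E' * P = P) (hQ : Q * E' = Q)
    (hQP : Q * P = Matrix.scalar (Fin 1) (N : O)) (hPQ : P * Q = Matrix.scalar (Fin m) (N : O) * E') (L : Type u) [Field L] [Algebra R L] :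
    Module.finrank L (Alg ((Over.pullback (Spec.map (CommRingCat.ofHom (algebraMap R L)))).obj (ker (serreTranslate act E' hE' P)))) =
      Module.finrank R (Alg (ker (serreTranslate act E' hE' P))) := by
  haveI := isAffine_ker_left act E' hE' P Q hN hP hQ hQP hPQ
  haveI := moduleFree_alg_ker act E' hE' P Q hN hP hQ hQP hPQ
  haveI := isMonHom_serreTranslate act E' hE' P
  exact AffineGroupScheme.finrank_alg_pullback_obj L

/-! ## §4 DOWN → UP: the geometric generic `𝔭`-torsion points are counted by the degree of the special fibre -/

/-- **(GF-d) `#{P ∈ A_K(K) | 𝔭P = 1} = dim_L Γ(A[𝔭]_L, 𝒪)`** over a LOCAL base `R`, for `K` an algebraically closed field under `R` in which `N ≠ 0` (a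
geometric GENERIC point in residue characteristic dividing `N`) and ANY field `L` under `R` (e.g. the residue field): the count upstairs is the degree of
`A_K[𝔭] ≅ A[𝔭]_K` (§2 + ★ (S-c) §3 `exists_baseChange_iso`), and all fibres of the finite flat `A[𝔭]` over the local `R` have the same degree (§3).
[cite: Tate1997FiniteFlatGroupSchemes, (3.7)] [cite: MumfordAV1970, §7 Thm. 4 (p. 72)] [cite: EGAIV2, §2.8 (Prop. 2.8.5)] -/
theorem natCard_idealTorsion_algPoints_baseChange_eq_finrank [IsLocalRing R] (hP : E' * P = P) (hQ : Q * E' = Q)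
    (hQP : Q * P = Matrix.scalar (Fin 1) (N : O)) (hPQ : P * Q = Matrix.scalar (Fin m) (N : O) * E')
    (K : Type u) [Field K] [IsAlgClosed K] [Algebra R K] (hN : (N : K) ≠ 0) (L : Type u) [Field L] [Algebra R L]
    {𝔭 : Ideal O} (h𝔭 : Ideal.span (Set.range fun k => P k 0) = 𝔭) :
    Nat.card {t : AlgPoints (A.baseChange (Spec.map (CommRingCat.ofHom (algebraMap R K)))).X K //
        ∀ a ∈ 𝔭, t ≫ (act.baseChange (Spec.map (CommRingCat.ofHom (algebraMap R K)))).i a = 1} =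
      Module.finrank L (Alg ((Over.pullback (Spec.map (CommRingCat.ofHom (algebraMap R L)))).obj (ker (serreTranslate act E' hE' P)))) := by
  have hN0 : N ≠ 0 := by
    rintro rfl
    exact hN (by simp)
  haveI : IsCommMonObj (A.baseChange (Spec.map (CommRingCat.ofHom (algebraMap R K)))).X :=
    isCommMonObj_baseChange (Spec.map (CommRingCat.ofHom (algebraMap R K)))
  rw [natCard_idealTorsion_algPoints_eq_finrank (act.baseChange (Spec.map (CommRingCat.ofHom (algebraMap R K)))) E' hE' P Q hN hP hQ hQP hPQ h𝔭]
  obtain ⟨e, -⟩ := exists_baseChange_iso act E' hE' P (Spec.map (CommRingCat.ofHom (algebraMap R K))) hP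
  obtain ⟨f, -⟩ := AdmIdealTransport.exists_algEquiv_of_iso e
  rw [f.toLinearEquiv.finrank_eq, finrank_alg_pullback_ker_eq act E' hE' P Q hN0 hP hQ hQP hPQ K,
    finrank_alg_pullback_ker_eq act E' hE' P Q hN0 hP hQ hQP hPQ L]

/-- **(GF-d) DOCK FORM — `#{P ∈ A_K(K) | 𝔭P = 1} = dim_L Γ(G′, 𝒪)` FOR ANY REALISATION `G′ ↪ A_L` OF THE `𝔭`-TORSION OF THE FIBRE `A_L`**: over a local base
`R`, with `K` algebraically closed under `R`, `N ≠ 0` in `K`, and `L` any field under `R`, if `ι′ : G′ ⟶ A_L` is a monomorphism with the kernel-of-`𝔭`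
clause on `T`-points (the D-line dock՚s `hkerG₀`, read with `Iff.symm`), then the geometric generic `𝔭`-torsion points number `dim_L Γ(G′, 𝒪)` (the dock՚s
`hrkG₀`): `G′ ≅ A_L[𝔭]` (★ (S-c) §4 `exists_iso_of_forall_iff`) `≅ A[𝔭]_L` (★ (S-c) §3), so `Γ(G′) ≅ Γ(A[𝔭]_L)` (★ `AdmIdealTransport.exists_algEquiv_of_iso`),
and `natCard_idealTorsion_algPoints_baseChange_eq_finrank`. [cite: Tate1997FiniteFlatGroupSchemes, (3.7)] [cite: GortzWedhorn2020, Definition 4.45 (2), p. 117]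
[cite: MumfordAV1970, §7 Thm. 4 (p. 72)] -/
theorem natCard_idealTorsion_algPoints_baseChange_eq_finrank_of_forall_iff (hE' : E' * E' = E') [IsLocalRing R] (hP : E' * P = P) (hQ : Q * E' = Q)
    (hQP : Q * P = Matrix.scalar (Fin 1) (N : O)) (hPQ : P * Q = Matrix.scalar (Fin m) (N : O) * E')
    (K : Type u) [Field K] [IsAlgClosed K] [Algebra R K] (hN : (N : K) ≠ 0) (L : Type u) [Field L] [Algebra R L]
    {𝔭 : Ideal O} (h𝔭 : Ideal.span (Set.range fun k => P k 0) = 𝔭)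
    {G' : SchemeOver L} [IsAffine G'.left] (ι' : G' ⟶ (A.baseChange (Spec.map (CommRingCat.ofHom (algebraMap R L)))).X) [Mono ι']
    (hG' : ∀ ⦃T : SchemeOver L⦄ (t : T ⟶ (A.baseChange (Spec.map (CommRingCat.ofHom (algebraMap R L)))).X),
      (∃ s : T ⟶ G', s ≫ ι' = t) ↔ ∀ a ∈ 𝔭, t ≫ (act.baseChange (Spec.map (CommRingCat.ofHom (algebraMap R L)))).i a = 1) :
    Nat.card {t : AlgPoints (A.baseChange (Spec.map (CommRingCat.ofHom (algebraMap R K)))).X K //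
        ∀ a ∈ 𝔭, t ≫ (act.baseChange (Spec.map (CommRingCat.ofHom (algebraMap R K)))).i a = 1} =
      Module.finrank L (Alg G') := by
  rw [natCard_idealTorsion_algPoints_baseChange_eq_finrank act E' hE' P Q hP hQ hQP hPQ K hN L h𝔭]
  haveI : IsCommMonObj (A.baseChange (Spec.map (CommRingCat.ofHom (algebraMap R L)))).X :=
    isCommMonObj_baseChange (Spec.map (CommRingCat.ofHom (algebraMap R L)))
  obtain ⟨e₁, -⟩ := exists_iso_of_forall_iff (act.baseChange (Spec.map (CommRingCat.ofHom (algebraMap R L)))) E' hE' P hP h𝔭 ι' hG'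
  obtain ⟨e₂, -⟩ := exists_baseChange_iso act E' hE' P (Spec.map (CommRingCat.ofHom (algebraMap R L))) hP
  obtain ⟨f, -⟩ := AdmIdealTransport.exists_algEquiv_of_iso (e₁ ≪≫ e₂.symm)
  exact f.toLinearEquiv.finrank_eq

end AffineBase

end IdealTorsion

end AbelianSchemeOver

end Literature.AlgebraicGeometry.AbelianSchemes

end
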